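import Literature.Analysis.OperatorTheory.Enflo2023.Lemma1Regime
import HarnessLib

/-!
# Enflo (2023), Lemma 1: the band `0 < (εθ)₀ ≤ 10⁻²⁰` and the threshold dichotomy for the printed choice of `u₁`

P. H. Enflo, *On the invariant subspace problem in Hilbert spaces*, arXiv:2305.15442v2, p. 1, pp. 6–9.

**What this file adds.**  After `Lemma1` (`lemma1_printed_of_ge`: the printed Lemma 1 holds for `(εθ)₀ ≥ 8·10⁻¹⁵`),
`Lemma1Standing` (`printed_lemma1_fails_standing`: it fails on a standing-form Type-1 model for every
`(εθ)₀ ∈ (10⁻²⁰, 1.72·10⁻¹⁵)`) and `Lemma1Regime` (`printed_lemma1_fails_in_regime`: it fails for every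
`(εθ)₀ ∈ (0, 2·10⁻²⁴]` with `(εθ)₀`-independent Type-1 constants), the status of the printed Lemma 1 on the band
`(εθ)₀ ∈ (2·10⁻²⁴, 10⁻²⁰]` was left undecided.  This file closes it — the printed Lemma 1 fails there too — so that the
verdict on the printed choice of `u₁` (v2 p. 7, "`‖T*u₁‖ < (εθ)₀`") becomes a clean THRESHOLD DICHOTOMY
(`printed_u1_choice_dichotomy`):
* for every `(εθ)₀ ∈ (0, 1.72·10⁻¹⁵)` there is an operator `T` on `ℓ²(ℕ)` in the standing form of v2 p. 1
  (`‖T‖ = 10⁻²⁰`, injective, dense non-closed range; here self-adjoint) of Type 1 ((19), v2 p. 6) and an orthonormal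
  pair `u₀, u₁` with `‖T*u₁‖ < (εθ)₀` for which the printed conclusion of Lemma 1 fails at EVERY radius
  `ε ∈ (½ − 10⁻⁵(εθ)₀, ½]`;
* for every `(εθ)₀ ∈ [8·10⁻¹⁵, 20]` the printed Lemma 1 holds for every `T` with `‖T‖ ≤ 10⁻²⁰` on every Hilbert space.
(The gap `[1.72·10⁻¹⁵, 8·10⁻¹⁵)` between the two constants is a matter of sharp constants in `Lemma1Model` /
`Lemma1.lemma1_printed_of_ge` and is immaterial: the manuscript uses Lemma 1 only for `(εθ)₀ ≪ δ_k ≤ 10⁻²⁰ᵏ`, v2 p. 8.)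

**The band.**  We reuse the block family `T_μ = [[q/2, μ],[μ, 0]] ⊕ diag(2q/(k+2))_{k≥0}` of `Lemma1Regime`
(`Regime.Treg μ`, `q = 10⁻²⁰`), whose standing-form properties (`Treg_injective`, `Treg_isSelfAdjoint`,
`Treg_denseRange`, `Treg_not_surjective`, `Treg_e0`, `adjoint_Treg_e1`) hold for every `μ ≠ 0`, and supply the two
estimates that `Lemma1Regime` proved only for `μ ≤ 10⁻²⁴`:
* `‖T_μ‖ = q` for `0 ≤ μ ≤ 7·10⁻²¹` (`norm_Treg_band`; the head `[[q/2, μ],[μ, 0]]` has norm `≤ q` iff `μ² ≤ q²/2`,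
  certified by the sum of squares `0.26a² − 0.7ab + 0.51b² = (51b − 35a)²/5100 + 0.0198a²`, `head_sq_le_band`);
* Type 1 via `e₀` for `0 < μ ≤ q/2` with EVEN exponents `j = 2n` in (19) (`Treg_cone_bound_even`, `Treg_type1_band`):
  writing `T_μⁿ|span{e₀,e₁} = [[p_n, r_n],[r_n, s_n]]` (`Regime.P`), the determinant identity
  `p_n s_n − r_n² = (−μ²)ⁿ` (`P_det`) and the entry bound `p_n, r_n, s_n ≤ qⁿ` (`P_le_pow`, needs `μ ≤ q/2`) give, on
  the cone `Re y₀ ≥ ‖y‖/100`, `Re⟨T_μ²ⁿy, y⟩ ≥ p|y₀|² − 2r|y₀||y₁| + s|y₁|² ≥ (ps − r²)|y₀|²/s ≥ (μ²/q)²ⁿ|y₀|²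
  ≥ 10⁻⁴(10²⁰μ²)²ⁿ‖y‖²`.  (Here `δ_n` depends on `μ = (εθ)₀/2`; that is harmless — the band lies outside the regime
  `(εθ)₀ ≪ δ_k` anyway, which is covered with `μ`-independent constants by `Lemma1Regime`.)
Then `Lemma1.printed_lemma1_fails_of_lever` (`n₀ = q/2`, `m₁ = μ = (εθ)₀/2`, lever `⟨u₁, Tu₀⟩ = μ`) gives the
failure for every `0 < (εθ)₀ ≤ 10⁻²⁰` (`printed_lemma1_fails_Treg_band`, `printed_lemma1_fails_in_band`).
Not modelled, as in `Lemma1Standing` / `Lemma1Regime`: cyclicity of `u₀` (`span{e₀,e₁}` reduces `T_μ`).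
Origin: planner-b2b-enflo-1-g13-0 (formaliser 1, gen 13), 2026-08-19.
-/

noncomputable section

open scoped InnerProductSpace ENNReal
open ContinuousLinearMap

namespace Literature.Analysis.OperatorTheory.Enflo2023

namespace Lemma1

open Vy
open Literature.Analysis.OperatorTheory.Enflo2023.Lemma1.Standing (e e_apply norm_e inner_e_left inner_e0_e1)

namespace Band

open Regime

/-! ### The norm of `T_μ` on the band `0 ≤ μ ≤ 7·10⁻²¹` -/

/-- Head terms, sharp up to `μ² ≤ q²/2`: for `0 ≤ μ ≤ 7·10⁻²¹`, `‖(T_μf)₀‖² + ‖(T_μf)₁‖² ≤ q²(‖f₀‖² + ‖f₁‖²)`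
(`q²I − B²`, `B = [[q/2, μ],[μ, 0]]`, is positive semidefinite iff `(μ² − q²/2)(μ² − 3q²/2) ≥ 0`). [folklore] -/
lemma head_sq_le_band (μ : ℝ) (hμ0 : 0 ≤ μ) (hμ1 : μ ≤ 7 / 10 ^ 21) (f : ℕ → ℂ) :
    ‖Tseq μ f 0‖ ^ 2 + ‖Tseq μ f 1‖ ^ 2 ≤ (1 / 10 ^ 20) ^ 2 * (‖f 0‖ ^ 2 + ‖f 1‖ ^ 2) := by
  have hA := norm_nonneg (f 0)
  have hB := norm_nonneg (f 1)
  have hT0 := norm_nonneg (Tseq μ f 0)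
  have h0 : ‖Tseq μ f 0‖ ≤ 1 / 10 ^ 20 / 2 * ‖f 0‖ + 7 / 10 ^ 21 * ‖f 1‖ := by
    rw [Tseq_zero]
    refine (norm_add_le _ _).trans ?_
    rw [norm_mul, norm_mul, Complex.norm_real, Complex.norm_real, Real.norm_of_nonneg (by positivity),
      Real.norm_of_nonneg hμ0]
    have := mul_le_mul_of_nonneg_right hμ1 hB
    linarith
  have h0sq : ‖Tseq μ f 0‖ ^ 2 ≤ (1 / 10 ^ 20 / 2 * ‖f 0‖ + 7 / 10 ^ 21 * ‖f 1‖) ^ 2 :=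
    pow_le_pow_left₀ hT0 h0 2
  have h1sq : ‖Tseq μ f 1‖ ^ 2 ≤ (7 / 10 ^ 21 * ‖f 0‖) ^ 2 := by
    rw [Tseq_one, norm_mul, Complex.norm_real, Real.norm_of_nonneg hμ0]
    exact pow_le_pow_left₀ (by positivity) (mul_le_mul_of_nonneg_right hμ1 hA) 2
  nlinarith [sq_nonneg (51 * ‖f 1‖ - 35 * ‖f 0‖), sq_nonneg ‖f 0‖]

/-- `‖T_μ‖ = 10⁻²⁰` on the band `0 ≤ μ ≤ 7·10⁻²¹` (attained at `e₂`). [cite: Enflo2023, v2 p.1 (‖T‖ = 10⁻²⁰ after scaling)] -/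
lemma norm_Treg_band (μ : ℝ) (hμ0 : 0 ≤ μ) (hμ1 : μ ≤ 7 / 10 ^ 21) : ‖Treg μ‖ = 1 / 10 ^ 20 := by
  refine le_antisymm (opNorm_le_bound _ (by norm_num) fun f => ?_) ?_
  · exact norm_TRlin_le_of_head μ le_rfl f (head_sq_le_band μ hμ0 hμ1 f)
  · have h1 := (Treg μ).le_opNorm (e 2)
    rw [Treg_e2, norm_smul, norm_e, Complex.norm_real, Real.norm_of_nonneg (by norm_num), mul_one,
      mul_one] at h1
    exact h1

/-- `‖T_μ‖ < 1` on the band. [folklore] -/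
lemma norm_Treg_band_lt_one (μ : ℝ) (hμ0 : 0 ≤ μ) (hμ1 : μ ≤ 7 / 10 ^ 21) : ‖Treg μ‖ < 1 := by
  rw [norm_Treg_band μ hμ0 hμ1]; norm_num

/-! ### Type 1 via `e₀` on the band `0 < μ ≤ q/2`, with even exponents -/

/-- The determinant identity `p_n s_n − r_n² = det(Bⁿ) = (−μ²)ⁿ` for the head `B = [[q/2, μ],[μ, 0]]` of `T_μ`. [folklore] -/
lemma P_det (μ : ℝ) : ∀ n : ℕ, (P μ n).1 * (P μ n).2.2 - (P μ n).2.1 ^ 2 = (-μ ^ 2) ^ n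
  | 0 => by simp
  | n + 1 => by
      have ih := P_det μ n
      have hs := P_sym μ n
      rw [P_succ]
      dsimp only
      linear_combination (μ * (P μ n).1) * hs + (-μ ^ 2) * ih

/-- Entry bound `p_n, r_n, s_n ≤ qⁿ` for `0 ≤ μ ≤ q/2` (`‖B‖ ≤ q/2 + μ ≤ q`). [folklore] -/
lemma P_le_pow (μ : ℝ) (hμ0 : 0 ≤ μ) (hμ1 : μ ≤ 1 / 10 ^ 20 / 2) : ∀ n : ℕ,
    (P μ n).1 ≤ (1 / 10 ^ 20) ^ n ∧ (P μ n).2.1 ≤ (1 / 10 ^ 20) ^ n ∧ (P μ n).2.2 ≤ (1 / 10 ^ 20) ^ n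
  | 0 => by simp
  | n + 1 => by
      obtain ⟨h1, h2, -⟩ := P_le_pow μ hμ0 hμ1 n
      rw [P_succ]
      dsimp only
      have hq : (0 : ℝ) ≤ (1 / 10 ^ 20) ^ n := by positivity
      have hqs : ((1 : ℝ) / 10 ^ 20) ^ (n + 1) = (1 / 10 ^ 20) ^ n * (1 / 10 ^ 20) := pow_succ _ _
      have ha : 1 / 10 ^ 20 / 2 * (P μ n).1 ≤ 1 / 10 ^ 20 / 2 * (1 / 10 ^ 20) ^ n :=
        mul_le_mul_of_nonneg_left h1 (by positivity)
      have hb : μ * (P μ n).2.1 ≤ 1 / 10 ^ 20 / 2 * (1 / 10 ^ 20) ^ n :=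
        (mul_le_mul_of_nonneg_left h2 hμ0).trans (mul_le_mul_of_nonneg_right hμ1 hq)
      have hc : μ * (P μ n).1 ≤ 1 / 10 ^ 20 / 2 * (1 / 10 ^ 20) ^ n :=
        (mul_le_mul_of_nonneg_left h1 hμ0).trans (mul_le_mul_of_nonneg_right hμ1 hq)
      refine ⟨?_, ?_, ?_⟩
      · rw [hqs]; linarith
      · rw [hqs]; linarith
      · rw [hqs]; linarith

/-- **Type-1 cone bound on the band, even exponents** ((19) of v2 p.6 with `j = 2n`): for `0 < μ ≤ q/2` and `y` in the
cone `Re y₀ ≥ ‖y‖/100`, `Re⟨T_μ²ⁿ y, y⟩ ≥ (p s − r²)|y₀|²/s ≥ (μ²/q)²ⁿ|y₀|² ≥ 10⁻⁴(10²⁰μ²)²ⁿ‖y‖²`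
(`[[p, r],[r, s]] = B²ⁿ`, `ps − r² = μ⁴ⁿ`, `0 < s ≤ q²ⁿ`). [cite: Enflo2023, v2 p.6 (19)] -/
theorem Treg_cone_bound_even (μ : ℝ) (hμ0 : 0 < μ) (hμ1 : μ ≤ 1 / 10 ^ 20 / 2) (n : ℕ) (f : ℓ2)
    (hf : Referee.AngleCond (e 0) f) :
    1 / 10 ^ 4 * (10 ^ 20 * μ ^ 2) ^ (2 * n) * ‖f‖ ^ 2 ≤ ‖⟪(⇑(Treg μ))^[2 * n] f, f⟫_ℂ‖ := by
  obtain ⟨-, hang⟩ := hf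
  rw [inner_e_left] at hang
  obtain ⟨hp, hr0, -, hs0⟩ := P_bounds μ hμ0.le (2 * n)
  obtain ⟨-, -, hsq⟩ := P_le_pow μ hμ0.le hμ1 (2 * n)
  have hdet := P_det μ (2 * n)
  obtain ⟨h0, h1⟩ := iterate_apply_head μ (2 * n) f
  set p := (P μ (2 * n)).1 with hp_def
  set r := (P μ (2 * n)).2.1 with hr_def
  set s := (P μ (2 * n)).2.2 with hs_def
  -- `D = p s − r² = μ^{4n} > 0`
  have hD : p * s - r ^ 2 = (μ ^ 2) ^ (2 * n) := by
    rw [hdet, pow_mul, pow_mul, neg_sq]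
  have hDpos : 0 < p * s - r ^ 2 := by rw [hD]; positivity
  have hsum := lp.summable_inner (𝕜 := ℂ) ((⇑(Treg μ))^[2 * n] f) f
  have htail : ∑' k, ⟪((⇑(Treg μ))^[2 * n] f) (k + 2), f (k + 2)⟫_ℂ =
      ((∑' k, wt k ^ (2 * n) * ‖f (k + 2)‖ ^ 2 : ℝ) : ℂ) := by
    rw [Complex.ofReal_tsum]
    congr 1
    funext k
    rw [iterate_apply_add_two, RCLike.inner_apply', map_mul, Complex.conj_ofReal, mul_assoc, Complex.conj_mul']
    push_cast
    ring
  have htail0 : 0 ≤ ∑' k, wt k ^ (2 * n) * ‖f (k + 2)‖ ^ 2 :=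
    tsum_nonneg fun k => by have := (wt_bounds k).1; positivity
  obtain ⟨w, hw_def⟩ : ∃ w : ℂ, w = (starRingEnd ℂ) (f 1) * f 0 + (starRingEnd ℂ) (f 0) * f 1 := ⟨_, rfl⟩
  have hw : ‖w‖ ≤ 2 * (‖f 0‖ * ‖f 1‖) := by
    rw [hw_def]
    refine (norm_add_le _ _).trans (le_of_eq ?_)
    rw [norm_mul, norm_mul, RCLike.norm_conj, RCLike.norm_conj]
    ring
  have hinner : ⟪(⇑(Treg μ))^[2 * n] f, f⟫_ℂ =
      ((p * ‖f 0‖ ^ 2 + s * ‖f 1‖ ^ 2 + ∑' k, wt k ^ (2 * n) * ‖f (k + 2)‖ ^ 2 : ℝ) : ℂ) + (r : ℂ) * w := by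
    rw [lp.inner_eq_tsum, tsum_split_two hsum, htail, h0, h1, RCLike.inner_apply', RCLike.inner_apply', hw_def]
    simp only [map_add, map_mul, Complex.conj_ofReal]
    push_cast
    rw [← Complex.conj_mul' (f 0), ← Complex.conj_mul' (f 1)]
    ring
  rw [hinner]
  refine le_trans ?_ ((le_abs_self _).trans (Complex.abs_re_le_norm _))
  rw [Complex.add_re, Complex.ofReal_re, Complex.re_ofReal_mul]
  have hwre : -(2 * (‖f 0‖ * ‖f 1‖)) ≤ w.re := neg_le_of_abs_le ((Complex.abs_re_le_norm w).trans hw)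
  have hf0 : 1 / 100 * ‖f‖ ≤ ‖f 0‖ := hang.trans ((le_abs_self _).trans (Complex.abs_re_le_norm _))
  have hF0 := norm_nonneg (f 0)
  have hF1 := norm_nonneg (f 1)
  have hF := norm_nonneg f
  have hp0 : 0 ≤ p := le_trans (by positivity) hp
  have hspos : 0 < s := by
    by_contra hs
    have hs' : s = 0 := le_antisymm (not_lt.1 hs) hs0
    rw [hs', mul_zero] at hDpos
    nlinarith [sq_nonneg r]
  -- the head quadratic form `Hd = p a² + s b² + r·Re w`
  set Hd := p * ‖f 0‖ ^ 2 + s * ‖f 1‖ ^ 2 + r * w.re with hHd_def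
  -- `s · Hd ≥ (p s − r²) a²`
  have hrw : -(2 * r * (‖f 0‖ * ‖f 1‖)) ≤ r * w.re := by
    have := mul_le_mul_of_nonneg_left hwre hr0
    linarith
  have h1' : (p * s - r ^ 2) * ‖f 0‖ ^ 2 ≤ s * Hd := by
    have hsr : 0 ≤ s * r := mul_nonneg hs0 hr0
    nlinarith [sq_nonneg (s * ‖f 1‖ - r * ‖f 0‖), mul_le_mul_of_nonneg_left hrw hs0]
  -- hence `Hd ≥ 0` and `q^{2n} Hd ≥ μ^{4n} a²`
  have hHd : 0 ≤ Hd := by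
    by_contra h
    have h' : s * Hd < 0 := mul_neg_of_pos_of_neg hspos (not_le.1 h)
    nlinarith [mul_nonneg hDpos.le (sq_nonneg ‖f 0‖)]
  have h2' : (μ ^ 2) ^ (2 * n) * ‖f 0‖ ^ 2 ≤ (1 / 10 ^ 20) ^ (2 * n) * Hd := by
    rw [← hD]
    exact h1'.trans (mul_le_mul_of_nonneg_right hsq hHd)
  -- rescale: `(10²⁰ μ²)^{2n} q^{2n} = (μ²)^{2n}`
  have hK : (10 ^ 20 * μ ^ 2) ^ (2 * n) * (1 / 10 ^ 20) ^ (2 * n) = (μ ^ 2) ^ (2 * n) := by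
    rw [← mul_pow]; congr 1; ring
  have hQ : (0 : ℝ) < (1 / 10 ^ 20) ^ (2 * n) := by positivity
  have h3' : (10 ^ 20 * μ ^ 2) ^ (2 * n) * ‖f 0‖ ^ 2 ≤ Hd := by
    refine le_of_mul_le_mul_left ?_ hQ
    calc (1 / 10 ^ 20) ^ (2 * n) * ((10 ^ 20 * μ ^ 2) ^ (2 * n) * ‖f 0‖ ^ 2)
        = (μ ^ 2) ^ (2 * n) * ‖f 0‖ ^ 2 := by rw [← hK]; ring
      _ ≤ (1 / 10 ^ 20) ^ (2 * n) * Hd := h2'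
  have hKnn : (0 : ℝ) ≤ (10 ^ 20 * μ ^ 2) ^ (2 * n) := by positivity
  have h4' : (10 ^ 20 * μ ^ 2) ^ (2 * n) * (1 / 100 * ‖f‖) ^ 2 ≤ (10 ^ 20 * μ ^ 2) ^ (2 * n) * ‖f 0‖ ^ 2 :=
    mul_le_mul_of_nonneg_left (pow_le_pow_left₀ (by positivity) hf0 2) hKnn
  have hgoal : p * ‖f 0‖ ^ 2 + s * ‖f 1‖ ^ 2 + (∑' k, wt k ^ (2 * n) * ‖f (k + 2)‖ ^ 2) + r * w.re
      = Hd + ∑' k, wt k ^ (2 * n) * ‖f (k + 2)‖ ^ 2 := by rw [hHd_def]; ring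
  rw [hgoal]
  nlinarith

/-- The band Type-1 constants are positive. [folklore] -/
lemma delta_even_pos (μ : ℝ) (hμ0 : 0 < μ) (n : ℕ) : (0 : ℝ) < 1 / 10 ^ 4 * (10 ^ 20 * μ ^ 2) ^ (2 * n) := by
  positivity

/-- `T_μ` is of Type 1 via `u₀ = e₀` (v2 p.6) for every `0 < μ ≤ q/2`, with `j = 2n` and
`δ_n = 10⁻⁴(10²⁰μ²)²ⁿ`. [cite: Enflo2023, v2 p.6 (19)] -/
theorem Treg_type1_band (μ : ℝ) (hμ0 : 0 < μ) (hμ1 : μ ≤ 1 / 10 ^ 20 / 2) : Referee.Type1 (Treg μ) :=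
  ⟨e 0, norm_e 0, fun n _ => ⟨_, delta_even_pos μ hμ0 n, fun y hy =>
    ⟨2 * n, by omega, Treg_cone_bound_even μ hμ0 hμ1 n y hy⟩⟩⟩

/-! ### The printed Lemma 1 fails on the band `0 < (εθ)₀ ≤ 10⁻²⁰` -/

/-- **The printed Lemma 1 fails for `(T_μ, e₀, e₁)`, `μ = (εθ)₀/2`, for EVERY `0 < (εθ)₀ ≤ 10⁻²⁰`.**
`T_μ e₀ = (q/2)e₀ + μe₁`, so the lever is `⟨e₁, T_μ e₀⟩ = μ = ‖T_μ* e₁‖ < (εθ)₀ ≤ 4μ` and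
`Lemma1.printed_lemma1_fails_of_lever` applies. [cite: Enflo2023, v2 p.7 (choice of u₁), pp.8–9 Lemma 1] -/
theorem printed_lemma1_fails_Treg_band {e₀ : ℝ} (he : 0 < e₀) (he1 : e₀ ≤ 1 / 10 ^ 20)
    (hT : ‖Treg (e₀ / 2)‖ < 1) :
    ‖adjoint (Treg (e₀ / 2)) (e 1)‖ < e₀ ∧
    ∀ (ε : ℝ) (a : ℓ2), 1 / 2 - e₀ / 10 ^ 5 < ε → ε ≤ 1 / 2 →
      IsMinimal (V (Treg (e₀ / 2)) hT (yStart (e 0))) (xStart (e 0) (e 1)) ε a →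
      e₀ / (2 * 10 ^ 5) <
        (⟪xStart (e 0) (e 1) - V (Treg (e₀ / 2)) hT (yStart (e 0)) a, V (Treg (e₀ / 2)) hT (yStart (e 0)) a⟫_ℂ).re := by
  have hμ0 : 0 ≤ e₀ / 2 := by positivity
  have hμ1 : e₀ / 2 ≤ 7 / 10 ^ 21 := by linarith
  refine ⟨by rw [norm_adjoint_Treg_e1 _ hμ0]; linarith, ?_⟩
  have hT20 : ‖Treg (e₀ / 2)‖ ≤ 1 / 10 ^ 20 := (norm_Treg_band _ hμ0 hμ1).le
  have hn₀ : ‖(((1 / 10 ^ 20 / 2 : ℝ)) : ℂ)‖ ≤ 1 := by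
    rw [Complex.norm_real, Real.norm_of_nonneg (by norm_num)]; norm_num
  have hm : e₀ ≤ 4 * ‖((e₀ / 2 : ℝ) : ℂ)‖ := by
    rw [Complex.norm_real, Real.norm_of_nonneg hμ0]; linarith
  exact printed_lemma1_fails_of_lever (Treg (e₀ / 2)) hT hT20 (e 0) (e 1) (norm_e 0) (norm_e 1) inner_e0_e1
    _ _ hn₀ (Treg_e0 (e₀ / 2)) he hm

/-- **Standing-form Type-1 counter-models to the printed Lemma 1 on the band (packaged).**  For EVERY
`(εθ)₀ ∈ (0, 10⁻²⁰]` there is, on `ℓ²(ℕ)`, an operator `T` in the standing form of v2 p.1 (`‖T‖ = 10⁻²⁰`, injective,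
dense non-closed range; self-adjoint), of Type 1 via `u₀ = e₀`, such that with the orthonormal pair `u₀ = e₀`,
`u₁ = e₁` the printed choice `‖T*u₁‖ < (εθ)₀` (p.7) holds (`‖T*u₁‖ = (εθ)₀/2`) while the printed conclusion of
Lemma 1 (`εθ(ℓ'_ε) ≤ ½·10⁻⁵(εθ)₀` for some `ε ∈ (½ − 10⁻⁵(εθ)₀, ½]`, pp.8–9) fails at EVERY radius of the window.
(Not modelled: cyclicity of `u₀`.) [cite: Enflo2023, v2 p.1, p.6 (19), p.7 (choice of u₁), pp.8–9 Lemma 1] -/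
theorem printed_lemma1_fails_in_band (e₀ : ℝ) (he : 0 < e₀) (he1 : e₀ ≤ 1 / 10 ^ 20) :
    ∃ (T : ℓ2 →L[ℂ] ℓ2) (hT : ‖T‖ < 1),
      ‖T‖ = 1 / 10 ^ 20 ∧ Function.Injective T ∧ DenseRange T ∧ ¬ Function.Surjective T ∧ IsSelfAdjoint T ∧
      ‖e 0‖ = 1 ∧ ‖e 1‖ = 1 ∧ ⟪e 0, e 1⟫_ℂ = 0 ∧
      (∀ n : ℕ, ∀ y : ℓ2, Referee.AngleCond (e 0) y →
          1 / 10 ^ 4 * (10 ^ 20 * (e₀ / 2) ^ 2) ^ (2 * n) * ‖y‖ ^ 2 ≤ ‖⟪(⇑T)^[2 * n] y, y⟫_ℂ‖) ∧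
      Referee.Type1 T ∧
      ‖adjoint T (e 1)‖ = e₀ / 2 ∧ ‖adjoint T (e 1)‖ < e₀ ∧
      ∀ (ε : ℝ) (a : ℓ2), 1 / 2 - e₀ / 10 ^ 5 < ε → ε ≤ 1 / 2 →
        IsMinimal (V T hT (yStart (e 0))) (xStart (e 0) (e 1)) ε a →
        e₀ / (2 * 10 ^ 5) < (⟪xStart (e 0) (e 1) - V T hT (yStart (e 0)) a, V T hT (yStart (e 0)) a⟫_ℂ).re := by
  have hμ0 : 0 < e₀ / 2 := by positivity
  have hμ1 : e₀ / 2 ≤ 7 / 10 ^ 21 := by linarith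
  have hμ2 : e₀ / 2 ≤ 1 / 10 ^ 20 / 2 := by linarith
  have hμ : e₀ / 2 ≠ 0 := hμ0.ne'
  have hT := norm_Treg_band_lt_one _ hμ0.le hμ1
  obtain ⟨hadj, hfail⟩ := printed_lemma1_fails_Treg_band he he1 hT
  exact ⟨Treg (e₀ / 2), hT, norm_Treg_band _ hμ0.le hμ1, Treg_injective _ hμ, Treg_denseRange _ hμ,
    Treg_not_surjective _, Treg_isSelfAdjoint _, norm_e 0, norm_e 1, inner_e0_e1,
    fun n y hy => Treg_cone_bound_even _ hμ0 hμ2 n y hy, Treg_type1_band _ hμ0 hμ2,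
    norm_adjoint_Treg_e1 _ hμ0.le, hadj, hfail⟩

/-! ### The threshold dichotomy for the printed choice of `u₁` -/

/-- **Failure of the printed Lemma 1 for EVERY `(εθ)₀ ∈ (0, 1.72·10⁻¹⁵)`** on a standing-form, self-adjoint, Type-1
operator on `ℓ²(ℕ)` with an orthonormal pair `u₀, u₁` satisfying the printed requirement `‖T*u₁‖ < (εθ)₀`: the band
`(0, 10⁻²⁰]` is `printed_lemma1_fails_in_band` (`T = T_{(εθ)₀/2}`), the range `(10⁻²⁰, 1.72·10⁻¹⁵)` is
`Lemma1.Standing.printed_lemma1_fails_standing` (`T = Tst`, `‖T*u₁‖ = 10⁻²⁰`). [cite: Enflo2023, v2 p.1, p.6 (19), p.7 (choice of u₁), pp.8–9 Lemma 1] -/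
theorem printed_lemma1_fails_below (e₀ : ℝ) (he : 0 < e₀) (he1 : e₀ < 1.72 / 10 ^ 15) :
    ∃ (T : ℓ2 →L[ℂ] ℓ2) (hT : ‖T‖ < 1) (u₀ u₁ : ℓ2),
      ‖T‖ = 1 / 10 ^ 20 ∧ Function.Injective T ∧ DenseRange T ∧ ¬ Function.Surjective T ∧ IsSelfAdjoint T ∧
      ‖u₀‖ = 1 ∧ ‖u₁‖ = 1 ∧ ⟪u₀, u₁⟫_ℂ = 0 ∧ Referee.Type1 T ∧
      ‖adjoint T u₁‖ < e₀ ∧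
      ¬ ∃ (ε : ℝ) (a : ℓ2), 1 / 2 - e₀ / 10 ^ 5 < ε ∧ ε ≤ 1 / 2 ∧
          IsMinimal (V T hT (yStart u₀)) (xStart u₀ u₁) ε a ∧
          (⟪xStart u₀ u₁ - V T hT (yStart u₀) a, V T hT (yStart u₀) a⟫_ℂ).re ≤ e₀ / (2 * 10 ^ 5) := by
  rcases le_or_gt e₀ (1 / 10 ^ 20) with h | h
  · obtain ⟨T, hT, h1, h2, h3, h4, h5, h6, h7, h8, -, h10, -, h12, h13⟩ := printed_lemma1_fails_in_band e₀ he h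
    refine ⟨T, hT, e 0, e 1, h1, h2, h3, h4, h5, h6, h7, h8, h10, h12, ?_⟩
    rintro ⟨ε, a, hε1, hε2, ha, hθ⟩
    exact absurd hθ (not_le.2 (h13 ε a hε1 hε2 ha))
  · obtain ⟨hadj, hno⟩ := Standing.printed_lemma1_fails_standing_all Standing.norm_Tst_lt_one h he1
    exact ⟨Standing.Tst, Standing.norm_Tst_lt_one, e 0, e 1, Standing.norm_Tst, Standing.Tst_injective,
      Standing.Tst_denseRange, Standing.Tst_not_surjective, Standing.Tst_isSelfAdjoint, norm_e 0, norm_e 1,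
      inner_e0_e1, Standing.Tst_type1, hadj, hno⟩

end Band

/-- **Threshold dichotomy for the printed choice of `u₁` (v2 p.7: "`‖T*u₁‖ < (εθ)₀`").**
(i) For every `(εθ)₀ ∈ (0, 1.72·10⁻¹⁵)` the printed Lemma 1 FAILS on some operator `T` on `ℓ²(ℕ)` in the standing
form of v2 p.1 (`‖T‖ = 10⁻²⁰`, injective, dense non-closed range; self-adjoint), of Type 1 ((19), p.6), with an
orthonormal pair `u₀, u₁` satisfying the printed requirement `‖T*u₁‖ < (εθ)₀`: no radius `ε ∈ (½ − 10⁻⁵(εθ)₀, ½]` has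
a minimiser with `εθ(ℓ'_ε) ≤ ½·10⁻⁵(εθ)₀`.  (ii) For every `(εθ)₀ ∈ [8·10⁻¹⁵, 20]` the printed Lemma 1 HOLDS for every
`T` with `‖T‖ ≤ 10⁻²⁰` and every orthonormal `u₀, u₁` on every Hilbert space (`Lemma1.lemma1_printed_of_ge`).
So the printed requirement on `u₁` is sufficient exactly when `(εθ)₀` is NOT small against `‖T‖ = 10⁻²⁰` — the
opposite of the manuscript's regime `(εθ)₀ ≪ δ_k ≤ 10⁻²⁰ᵏ` (p.8); the repaired requirement `‖T*u₁‖ ≤ 1.25·10⁻⁶(εθ)₀`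
(`Lemma1.lemma1_repaired`) works for all `(εθ)₀ ∈ (0, 20]`. [cite: Enflo2023, v2 p.1, p.6 (19), p.7 (choice of u₁), p.8, pp.8–9 Lemma 1] -/
theorem printed_u1_choice_dichotomy {H : Type*} [NormedAddCommGroup H] [InnerProductSpace ℂ H] [CompleteSpace H] :
    (∀ e₀ : ℝ, 0 < e₀ → e₀ < 1.72 / 10 ^ 15 →
      ∃ (T : ℓ2 →L[ℂ] ℓ2) (hT : ‖T‖ < 1) (u₀ u₁ : ℓ2),
        ‖T‖ = 1 / 10 ^ 20 ∧ Function.Injective T ∧ DenseRange T ∧ ¬ Function.Surjective T ∧ IsSelfAdjoint T ∧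
        ‖u₀‖ = 1 ∧ ‖u₁‖ = 1 ∧ ⟪u₀, u₁⟫_ℂ = 0 ∧ Referee.Type1 T ∧
        ‖adjoint T u₁‖ < e₀ ∧
        ¬ ∃ (ε : ℝ) (a : ℓ2), 1 / 2 - e₀ / 10 ^ 5 < ε ∧ ε ≤ 1 / 2 ∧
            IsMinimal (V T hT (yStart u₀)) (xStart u₀ u₁) ε a ∧
            (⟪xStart u₀ u₁ - V T hT (yStart u₀) a, V T hT (yStart u₀) a⟫_ℂ).re ≤ e₀ / (2 * 10 ^ 5)) ∧
    (∀ e₀ : ℝ, 8 / 10 ^ 15 ≤ e₀ → e₀ ≤ 20 →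
      ∀ (T : H →L[ℂ] H) (hT : ‖T‖ < 1), ‖T‖ ≤ 1 / 10 ^ 20 → ∀ u₀ u₁ : H,
        ‖u₀‖ = 1 → ‖u₁‖ = 1 → ⟪u₀, u₁⟫_ℂ = 0 →
        ∃ (ε : ℝ) (a : ℓ2), 1 / 2 - e₀ / 10 ^ 5 ≤ ε ∧ ε ≤ 1 / 2 ∧
          IsMinimal (V T hT (yStart u₀)) (xStart u₀ u₁) ε a ∧
          (⟪xStart u₀ u₁ - V T hT (yStart u₀) a, V T hT (yStart u₀) a⟫_ℂ).re ≤ e₀ / (2 * 10 ^ 5)) := by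
  refine ⟨fun e₀ he he1 => ?_, fun e₀ he he' T hT hT20 u₀ u₁ hu₀ hu₁ h01 =>
    lemma1_printed_of_ge T hT hT20 u₀ u₁ hu₀ hu₁ h01 he he'⟩
  exact Band.printed_lemma1_fails_below e₀ he he1

end Lemma1

end Literature.Analysis.OperatorTheory.Enflo2023
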